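import Mathlib
import Summits.Ventures.HodgeRepro.Tier4.Target
import Summits.Ventures.HodgeRepro.Tier4.Line3.Defs
import Summits.Ventures.HodgeRepro.Tier4.Line3.LocaliserS
import Summits.Ventures.HodgeRepro.Tier4.Line3.ClassBoundGauss

/-!
# Tier4/Line3/TermMajorantMass — step A of the assembly of L3.5: the orbital term is bounded by the decay times the
orbit's majorant mass (rung for L3.5)

Blind re-derivation cell `pub-hodge-repro`, Tier 4 «PROVE THE STEP» (README §9–§10), LINE L3, seat t4-L2-p3 on L3.5
`term_dominated` (lead S12234).

Given the CLASS BOUND in the shape of `ClassBound.summand_bound_off_main` (a hypothesis `hclass` here, so that this module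
depends only on the definitions and on `majorantAt`), the orbital term of an off-main orbit `o` at depth `N` is bounded by
`B C₁ e^{−κ (N(𝔭)^N)^{1/d}}` times the orbit's MAJORANT MASS `∫_{D_N} Σ'_{w ∈ o} majorantAt Φ e w z dz`
(`norm_term_le_of_class_bound`): `‖∫ f‖ ≤ ∫ ‖f‖`, `‖Σ' a_w‖ ≤ Σ' ‖a_w‖` on the orbit (summable by comparison with the
majorant), and `integral_mono_of_nonneg` (no integrability of the left side needed; the majorant mass is assumed
integrable — part of the residual `MajorantIntegralBound` of S12633).  Also `domain_subset_ball` and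
`measurableSet_domain` for the chosen fundamental domain of a level.

What remains for L3.5 after this step: `Σ_o (orbit mass) ≤ ∫_{D_N} Σ'_w majorantAt ≤ M₀ q₁^N` (the orbit partition of the
lines and the residual bound) and the nonneg double sum over `(N, o)` with `DecaySum`.

Nothing here asserts anything about the truth of (P); HC_CM is NOT proved by anyone in this repository.
-/

set_option autoImplicit false

noncomputable section

namespace Summit.Ventures.HodgeRepro.Tier4.Line3

open MeasureTheory

namespace T4Data

variable (X : T4Data)

/-- The chosen domain of a level lies in the ball (or is empty). -/
theorem domain_subset_ball (K : X.Level) : X.domain K ⊆ ball := by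
  unfold domain
  split_ifs with hD
  · exact (Classical.choose_spec hD).1.2.1
  · exact Set.empty_subset _

/-- The chosen domain of a level is measurable. -/
theorem measurableSet_domain (K : X.Level) : MeasurableSet (X.domain K) := by
  unfold domain
  split_ifs with hD
  · exact (Classical.choose_spec hD).1.1
  · exact MeasurableSet.empty

/-- **STEP A OF THE ASSEMBLY**: from the class bound, the orbital term of an off-main orbit is bounded by the decay
`B C₁ e^{−κ q^{N/d}}` times the orbit's MAJORANT MASS `∫_{D_N} Σ'_{w ∈ o} majorantAt`. -/
theorem norm_term_le_of_class_bound (D : X.ThetaData)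
    (p : IsDedekindDomain.HeightOneSpectrum (NumberField.RingOfIntegers X.E))
    (L₀ : Submodule (NumberField.RingOfIntegers X.E) (Fin 3 → X.E)) (xm : X.Tuple) (ℓ : X.LocS D p L₀ xm)
    (B e κ C₁ : ℝ)
    (hclass : ∀ (N : ℕ) (w : X.LineTuple) (z : Fin 2 → ℂ), z ∈ ball →
      X.orbitOf w ≠ X.orbitOf (X.lines xm) →
      ‖X.summand D.Φ D.cf (ℓ.loc N) w z‖ ≤ B * X.majorantAt D.Φ e w z *
        (C₁ * Real.exp (-(κ * (((Ideal.absNorm p.asIdeal : ℝ) ^ N) ^ ((Module.finrank ℚ X.E : ℝ)⁻¹))))))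
    (hsumm : ∀ N (z : Fin 2 → ℂ), z ∈ X.domain (ℓ.level N) → Summable (fun w => X.majorantAt D.Φ e w z))
    (hint_orbit : ∀ N (o : X.Orbit), IntegrableOn
      (fun z => ∑' w : {w : X.LineTuple // X.orbitOf w = o}, X.majorantAt D.Φ e w.1 z) (X.domain (ℓ.level N)))
    (N : ℕ) (o : X.Orbit) (ho : o ≠ X.orbitOf (X.lines xm)) :
    ‖X.term D.Φ D.cf (ℓ.level N) (ℓ.loc N) o‖ ≤
      (B * C₁ * Real.exp (-(κ * (((Ideal.absNorm p.asIdeal : ℝ) ^ N) ^ ((Module.finrank ℚ X.E : ℝ)⁻¹))))) *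
        ∫ z in X.domain (ℓ.level N), ∑' w : {w : X.LineTuple // X.orbitOf w = o}, X.majorantAt D.Φ e w.1 z := by
  unfold term
  set eN : ℝ := Real.exp (-(κ * (((Ideal.absNorm p.asIdeal : ℝ) ^ N) ^ ((Module.finrank ℚ X.E : ℝ)⁻¹)))) with heN
  have heN0 : 0 ≤ eN := (Real.exp_pos _).le
  refine (norm_integral_le_integral_norm _).trans ?_
  rw [← integral_const_mul]
  refine integral_mono_of_nonneg (Filter.Eventually.of_forall fun z => norm_nonneg _)
    ((hint_orbit N o).const_mul _) ?_
  refine (ae_restrict_iff' (X.measurableSet_domain _)).mpr (Filter.Eventually.of_forall fun z hz => ?_)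
  have hzb : z ∈ ball := X.domain_subset_ball _ hz
  -- the pointwise bound on the orbit's summands
  have hsub : Summable (fun w : {w : X.LineTuple // X.orbitOf w = o} => X.majorantAt D.Φ e w.1 z) :=
    (hsumm N z hz).subtype _
  have hbound : ∀ w : {w : X.LineTuple // X.orbitOf w = o},
      ‖X.summand D.Φ D.cf (ℓ.loc N) w.1 z‖ ≤ (B * C₁ * eN) * X.majorantAt D.Φ e w.1 z := by
    intro w
    have h := hclass N w.1 z hzb (by rw [w.2]; exact ho)
    calc ‖X.summand D.Φ D.cf (ℓ.loc N) w.1 z‖ ≤ B * X.majorantAt D.Φ e w.1 z * (C₁ * eN) := h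
      _ = (B * C₁ * eN) * X.majorantAt D.Φ e w.1 z := by ring
  have hsumm_norm : Summable (fun w : {w : X.LineTuple // X.orbitOf w = o} =>
      ‖X.summand D.Φ D.cf (ℓ.loc N) w.1 z‖) :=
    Summable.of_nonneg_of_le (fun w => norm_nonneg _) hbound (hsub.mul_left _)
  calc ‖∑' w : {w : X.LineTuple // X.orbitOf w = o}, X.summand D.Φ D.cf (ℓ.loc N) w.1 z‖
      ≤ ∑' w : {w : X.LineTuple // X.orbitOf w = o}, ‖X.summand D.Φ D.cf (ℓ.loc N) w.1 z‖ :=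
        norm_tsum_le_tsum_norm hsumm_norm
    _ ≤ ∑' w : {w : X.LineTuple // X.orbitOf w = o}, (B * C₁ * eN) * X.majorantAt D.Φ e w.1 z :=
        Summable.tsum_le_tsum hbound hsumm_norm (hsub.mul_left _)
    _ = (B * C₁ * eN) * ∑' w : {w : X.LineTuple // X.orbitOf w = o}, X.majorantAt D.Φ e w.1 z :=
        tsum_mul_left

end T4Data

end Summit.Ventures.HodgeRepro.Tier4.Line3

end
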